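import Summits.BirchSwinnertonDyer.BirchSwinnertonDyer.Theorems.PrintCFramBottomClassIndexLawFiveLeAnchorReduction
import Summits.BirchSwinnertonDyer.Rank1Residual.X12.RamifiedSelmerCardRoute
import HarnessLib

/-!
# Crux `PrintCFram.BottomClassIndexLawFiveLe` (stmt-BirchSwinnertonDyer-20372), line `relative-anchor-transfer`
# (sha16 72dde5b866033574), stub `stub_unitAnchor`: the UNIT-STRATUM ANCHOR at EVERY ramified `p ≥ 5` —
# a rank-one member with the two certified data `#Sel^{(p)}(W₀/ℚ) ∣ p` and `ord_p #Ш_an(W₀) = 0` IS an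
# anchor, modulo Cassels / modularity / GZK; hence the stub ⟸ SEVEN such members (cell `bsd-print-cfram`,
# width seat `bsd-line-cfram-p1-w2`; THEOREMS ONLY, `--supports` 20372; nothing certified here, no stub
# closed; BSD is not proved by any of this)

HONEST FRAMING. Third file of the anchor side (after `…AnchorReduction.lean` p606463: the stub ⟸ seven
rank-one `BSD_p` certificates; `…AnchorSeven.lean`: the two `p = 7` classes at Route U's price). The line card
intends the anchors to be UNIT members (`B(W₀) = 0`: generators `p`-indivisible, `p ∤ #Ш_an`) and proposes to
cash them through [BKNO] Thm 4.12 + one certified central value + the `p`-adic period valuation (§1.4 input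
[8], not in print). THIS FILE shows the period / interpolation inputs are NOT NEEDED for the anchor: in the
tree, a unit member is an anchor by DESCENT alone —

* §1 `rubinFormulaAtZp_of_unit_member` — for a globally minimal CM `W₀` with `CMRamified W₀ p`, `r_an(W₀) = 1`,
  `#Ш_an(W₀) = q ∈ ℚ` with `ord_p q = 0` and the descent certificate `#Sel^{(p)}(W₀/ℚ) ∣ p`: the analytic
  ramified Rubin formula `S_open(W₀, p)` holds, granted GZK (rank `1`, `Ш` finite), Cassels and entire
  continuation. Chain: sibling cell's `X12.bsdp_of_classX12_of_card_selmerGroup_dvd` (GZK + certificate ⟹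
  `#Sel^{(p)} = p` ⟹ `Ш[p] = 0` ⟹ `BSDp W₀ p` with `ord_p #Ш_an = 0`) then cell `bsd-cm`'s
  `RubinFormulaZpBsdp.ramifiedCMRubinFormulaAtZp_of_bsdp`. ANY ramified `p ≥ 5`, any class.
* §2 `stub_unitAnchor_of_unit_members` — hence the registered `stub_unitAnchor` VERBATIM ⟸ the three named
  facts + SEVEN displayed unit members, one per leaf class `(7, −3375)`, `(7, 16581375)`, `(11, −32768)`,
  `(19, −884736)`, `(43, −884736000)`, `(67, −147197952000)`, `(163, −262537412640768000)`, each carrying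
  exactly: a globally minimal model, `j`, `r_an = 1`, `#Ш_an ∈ ℚ` a `p`-adic unit, `#Sel^{(p)} ∣ p`.
So the anchor stub is COMPUTATION-SIZED modulo the route's refereed facts: per class ONE `p`-descent
certificate (`E[𝔭]` is a rational line at the ramified `p`, so a `𝔭`-isogeny descent — Route U's two-engine
pattern at `p = 7`; Gross's `𝔭`-descent on `A(p)`) and ONE exact `#Ш_an` (Gross–Zagier Heegner index) — NOT
the `p`-adic period valuation, and NOT a rank-one `p`-adic Gross–Zagier formula. The natural candidates at
`p ∈ {11, 19, 43, 67, 163}` are Gross's curves `A(p) = 121b1, 361a1, 1849a1, 4489a1, 26569a1` themselves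
(`r_an = 1`: root number `−1` for `p ≡ 3 (mod 8)`, Miller–Yang 2000; predicted `#Ш = 1`). Nothing is
certified in this file (kit 0 on this seat); every datum is a displayed binder. beyond-print theorem: NO.

References: [Miller2011LMS] §1, Def. 1.1 (arXiv:1010.2431 p. 3); [SilvermanAEC2009] Thm X.4.2 (a);
[Cassels1965ArithmeticVIII]; [Gross1980LNM776] §§22–24 (descent on `A(p)`; context); [BuhlerGross1985] Ch. II;
[BurungaleKobayashiNakamuraOta2026] arXiv:2608.06879 §1.4, Thm 4.12, Thm 7.2 (shape only).
-/

noncomputable section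

-- summit-side namespace `Summit.BirchSwinnertonDyer.BirchSwinnertonDyer.…` (single-conjunct summit, D-0017 layout)
set_option linter.dupNamespace false

open scoped Classical

open WeierstrassCurve Literature.NumberTheory.EllipticCurves Literature.NumberTheory.EllipticCurves.Rank1Residual
  Summit.BirchSwinnertonDyer.Rank1Residual
  Summit.BirchSwinnertonDyer.Rank1Residual.X12.O11
  Summit.BirchSwinnertonDyer.BirchSwinnertonDyer.Theorems.RamifiedSevenEllipticUnits

namespace Summit.BirchSwinnertonDyer.BirchSwinnertonDyer.Theorems.PrintCFram.AnchorReduction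

/-! ## §1 A unit member is an anchor, at every ramified `p ≥ 5` (descent alone) -/

/-- **Unit member ⟹ anchor.** For a globally minimal CM curve `W₀/ℚ`, a prime `p` ramified in its CM field
(`CMRamified W₀ p`), `r_an(W₀) = 1`, Miller's `#Ш_an(W₀) = q ∈ ℚ` with `ord_p q = 0`, and the `p`-descent
certificate `#Sel^{(p)}(W₀/ℚ) ∣ p`: the analytic ramified Rubin formula `X12.O11.RamifiedCMRubinFormulaAtZp W₀ p`
holds, granted GZK, Cassels' isogeny invariance and entire continuation. Chain:
`X12.bsdp_of_classX12_of_card_selmerGroup_dvd` (the pair is X12 through the `CMRamified` clause) ⟹ `BSDp W₀ p`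
⟹ `RubinFormulaZpBsdp.ramifiedCMRubinFormulaAtZp_of_bsdp`. No `p`-adic period, no interpolation formula, no IMC
piece. CONDITIONAL on the three named facts and the two displayed data. [cite: Miller2011LMS, §1 and Def. 1.1 (arXiv:1010.2431 p. 3)]
[cite: SilvermanAEC2009, Thm X.4.2 (a)] [cite: Cassels1965ArithmeticVIII] -/
theorem rubinFormulaAtZp_of_unit_member (hCassels : bsdRHS_eq_of_isIsogenous) (hmod : hasEntireLFunction_rat)
    (hGZK : rank_eq_analyticRank_of_analyticRank_le_one) {p : ℕ} [Fact p.Prime]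
    {W₀ : WeierstrassCurve ℚ} [W₀.IsElliptic] [W₀.IsGloballyMinimal]
    (hCM : W₀.HasCM) (hram : CMRamified W₀ p) (hr : W₀.analyticRank = 1)
    {q : ℚ} (hq : shaAn W₀ = (q : ℂ)) (hv : padicValRat p q = 0)
    (hdvd : Nat.card (W₀.selmerGroup (p : ℤ)) ∣ p) : RamifiedCMRubinFormulaAtZp W₀ p :=
  RubinFormulaZpBsdp.ramifiedCMRubinFormulaAtZp_of_bsdp hCassels hmod hGZK hr.le
    (X12.bsdp_of_classX12_of_card_selmerGroup_dvd hGZK W₀ p ⟨hCM, hr, Or.inr (Or.inr (Or.inl hram))⟩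
      hq hv hdvd)

/-- **Unit member of class `j₀` ⟹ the displayed anchor of class `j₀`** (the `∃`-shape consumed by
`stub_unitAnchor_of_anchors`), for `j₀` one of the seven leaf values (CM and `CMRamified` are read off `j₀`).
CONDITIONAL on the three named facts and the displayed data. [cite: Miller2011LMS, §1 and Def. 1.1 (arXiv:1010.2431 p. 3)]
[cite: SilvermanATAEC1994, App. A §3 (table of CM j-invariants)] -/
theorem anchor_of_unit_member (hCassels : bsdRHS_eq_of_isIsogenous) (hmod : hasEntireLFunction_rat)
    (hGZK : rank_eq_analyticRank_of_analyticRank_le_one) {p : ℕ} [Fact p.Prime] {j₀ : ℚ}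
    (hcl : (p = 7 ∧ (j₀ = -3375 ∨ j₀ = 16581375)) ∨ (p = 11 ∧ j₀ = -32768) ∨ (p = 19 ∧ j₀ = -884736) ∨
      (p = 43 ∧ j₀ = -884736000) ∨ (p = 67 ∧ j₀ = -147197952000) ∨
      (p = 163 ∧ j₀ = -262537412640768000))
    (h : ∃ (W₀ : WeierstrassCurve ℚ) (_ : W₀.IsElliptic) (_ : W₀.IsGloballyMinimal),
      W₀.j = j₀ ∧ W₀.analyticRank = 1 ∧ (∃ q : ℚ, shaAn W₀ = (q : ℂ) ∧ padicValRat p q = 0) ∧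
        Nat.card (W₀.selmerGroup (p : ℤ)) ∣ p) :
    ∃ (W₀ : WeierstrassCurve ℚ) (_ : W₀.IsElliptic) (_ : W₀.IsGloballyMinimal),
      W₀.j = j₀ ∧ W₀.analyticRank = 1 ∧ RamifiedCMRubinFormulaAtZp W₀ p := by
  obtain ⟨W₀, _, _, hj, hr, ⟨q, hq, hv⟩, hdvd⟩ := h
  have hj₀ : j₀ = -3375 ∨ j₀ = 16581375 ∨ j₀ = -32768 ∨ j₀ = -884736 ∨ j₀ = -884736000 ∨
      j₀ = -147197952000 ∨ j₀ = -262537412640768000 := by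
    rcases hcl with ⟨-, h | h⟩ | ⟨-, h⟩ | ⟨-, h⟩ | ⟨-, h⟩ | ⟨-, h⟩ | ⟨-, h⟩ <;> simp [h]
  exact ⟨W₀, ‹_›, ‹_›, hj, hr,
    rubinFormulaAtZp_of_unit_member hCassels hmod hGZK (hasCM_of_j_eq W₀ hj₀ hj)
      (cmRamified_of_j_eq W₀ hcl hj) hr hq hv hdvd⟩

/-! ## §2 `stub_unitAnchor` from SEVEN unit members (modulo the route's refereed facts) -/

/-- **`stub_unitAnchor` ⟸ seven unit members.** Granted Cassels' isogeny invariance, entire continuation and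
GZK (three conjuncts of the route item S4 `PublishedFactsCFram`), seven displayed UNIT MEMBERS — for each leaf
class `(p₀, j₀)` a globally minimal elliptic `W₀` with `j(W₀) = j₀`, `r_an(W₀) = 1`, `#Ш_an(W₀) ∈ ℚ` a `p₀`-adic
unit and `#Sel^{(p₀)}(W₀/ℚ) ∣ p₀` — give the registered stub `stub_unitAnchor` of line `relative-anchor-transfer`
VERBATIM (§1 per class, then `stub_unitAnchor_of_anchors`). The seven data are COMPUTATIONS (one `𝔭`-isogeny
descent + one exact `#Ш_an` per class), none certified here; CONDITIONAL on them and on the three named facts.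
[cite: Miller2011LMS, §1 and Def. 1.1 (arXiv:1010.2431 p. 3)] [cite: SilvermanAEC2009, Thm X.4.2 (a)]
[cite: Cassels1965ArithmeticVIII] -/
theorem stub_unitAnchor_of_unit_members (hCassels : bsdRHS_eq_of_isIsogenous)
    (hmod : hasEntireLFunction_rat) (hGZK : rank_eq_analyticRank_of_analyticRank_le_one)
    (h7a : ∃ (W₀ : WeierstrassCurve ℚ) (_ : W₀.IsElliptic) (_ : W₀.IsGloballyMinimal),
      W₀.j = -3375 ∧ W₀.analyticRank = 1 ∧ (∃ q : ℚ, shaAn W₀ = (q : ℂ) ∧ padicValRat 7 q = 0) ∧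
        Nat.card (W₀.selmerGroup (7 : ℤ)) ∣ 7)
    (h7b : ∃ (W₀ : WeierstrassCurve ℚ) (_ : W₀.IsElliptic) (_ : W₀.IsGloballyMinimal),
      W₀.j = 16581375 ∧ W₀.analyticRank = 1 ∧ (∃ q : ℚ, shaAn W₀ = (q : ℂ) ∧ padicValRat 7 q = 0) ∧
        Nat.card (W₀.selmerGroup (7 : ℤ)) ∣ 7)
    (h11 : ∃ (W₀ : WeierstrassCurve ℚ) (_ : W₀.IsElliptic) (_ : W₀.IsGloballyMinimal),
      W₀.j = -32768 ∧ W₀.analyticRank = 1 ∧ (∃ q : ℚ, shaAn W₀ = (q : ℂ) ∧ padicValRat 11 q = 0) ∧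
        Nat.card (W₀.selmerGroup (11 : ℤ)) ∣ 11)
    (h19 : ∃ (W₀ : WeierstrassCurve ℚ) (_ : W₀.IsElliptic) (_ : W₀.IsGloballyMinimal),
      W₀.j = -884736 ∧ W₀.analyticRank = 1 ∧ (∃ q : ℚ, shaAn W₀ = (q : ℂ) ∧ padicValRat 19 q = 0) ∧
        Nat.card (W₀.selmerGroup (19 : ℤ)) ∣ 19)
    (h43 : ∃ (W₀ : WeierstrassCurve ℚ) (_ : W₀.IsElliptic) (_ : W₀.IsGloballyMinimal),
      W₀.j = -884736000 ∧ W₀.analyticRank = 1 ∧ (∃ q : ℚ, shaAn W₀ = (q : ℂ) ∧ padicValRat 43 q = 0) ∧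
        Nat.card (W₀.selmerGroup (43 : ℤ)) ∣ 43)
    (h67 : ∃ (W₀ : WeierstrassCurve ℚ) (_ : W₀.IsElliptic) (_ : W₀.IsGloballyMinimal),
      W₀.j = -147197952000 ∧ W₀.analyticRank = 1 ∧
        (∃ q : ℚ, shaAn W₀ = (q : ℂ) ∧ padicValRat 67 q = 0) ∧ Nat.card (W₀.selmerGroup (67 : ℤ)) ∣ 67)
    (h163 : ∃ (W₀ : WeierstrassCurve ℚ) (_ : W₀.IsElliptic) (_ : W₀.IsGloballyMinimal),
      W₀.j = -262537412640768000 ∧ W₀.analyticRank = 1 ∧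
        (∃ q : ℚ, shaAn W₀ = (q : ℂ) ∧ padicValRat 163 q = 0) ∧ Nat.card (W₀.selmerGroup (163 : ℤ)) ∣ 163) :
    ∀ (W : WeierstrassCurve ℚ) [W.IsElliptic] [W.IsGloballyMinimal] (p : ℕ) [Fact p.Prime],
      W.HasCM → CMRamified W p → 5 ≤ p → W.analyticRank = 1 →
      ∃ (W₀ : WeierstrassCurve ℚ) (_ : W₀.IsElliptic) (_ : W₀.IsGloballyMinimal),
        W₀.HasCM ∧ CMRamified W₀ p ∧ W₀.analyticRank = 1 ∧ W₀.j = W.j ∧ RamifiedCMRubinFormulaAtZp W₀ p :=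
  stub_unitAnchor_of_anchors
    (fun {_} => anchor_of_unit_member hCassels hmod hGZK (Or.inl ⟨rfl, Or.inl rfl⟩) h7a)
    (fun {_} => anchor_of_unit_member hCassels hmod hGZK (Or.inl ⟨rfl, Or.inr rfl⟩) h7b)
    (fun {_} => anchor_of_unit_member hCassels hmod hGZK (Or.inr (Or.inl ⟨rfl, rfl⟩)) h11)
    (fun {_} => anchor_of_unit_member hCassels hmod hGZK (Or.inr (Or.inr (Or.inl ⟨rfl, rfl⟩))) h19)
    (fun {_} => anchor_of_unit_member hCassels hmod hGZK (Or.inr (Or.inr (Or.inr (Or.inl ⟨rfl, rfl⟩)))) h43)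
    (fun {_} => anchor_of_unit_member hCassels hmod hGZK
      (Or.inr (Or.inr (Or.inr (Or.inr (Or.inl ⟨rfl, rfl⟩))))) h67)
    (fun {_} => anchor_of_unit_member hCassels hmod hGZK
      (Or.inr (Or.inr (Or.inr (Or.inr (Or.inr ⟨rfl, rfl⟩))))) h163)

end Summit.BirchSwinnertonDyer.BirchSwinnertonDyer.Theorems.PrintCFram.AnchorReduction

end
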